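import Summits.CriticalPhenomena.PercolationContinuityZ3.Theorems.PercNearOneGluingNoHeavyLowerTailSunflowerMultiPetalKempeNormalForm
import HarnessLib
import HarnessLib.Audit

/-!
# `NoHeavyLowerTail` (crux stmt-CriticalPhenomena-4575), Lemma B for graph clutters: the KEMPE IDENTITY
# `3·Q(G) = 6·|A*| + 3·Σ_{2-matchings}(L₌ − Λ) + Σ_{3-matchings} Σ_pairs (L₌ − Λ)`

Support file (seat `prim-l12-p2` gen 40; `--supports stmt-CriticalPhenomena-4575`; companion of `…SunflowerMultiPetalKempeChain`
(p403220/p403831: `KReach`, `kflip`, `kempe_pair_card_eq`) and `…SunflowerMultiPetalKempeNormalForm` (colouring-language `Qcol`,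
`monoSet`, `Astar`, `fiber`, `pairVal`, the pointwise normal form `three_qcol_eq`)).  No `sorry`; nothing is asserted about the crux.
Memo: run/shared/lean/prim/prim-l12/prim-l12-p2/FINDING-g39b-KEMPE-IDENTITY-AND-LINKED-CONJECTURE.md §2–§4.

For a class `F(M)` (colourings whose monochromatic set is exactly `M`) and two distinct edges `e, f ∈ M` put
`Λ(M;e,f) = LK` := the number of `σ ∈ F(M)` in which `e, f` carry DIFFERENT colours `a ≠ b` and are Kempe-LINKED (joined by a path of
`G` all of whose vertices are coloured `a` or `b`), and `L₌(M;e,f) = LE` := the number of pairs `(σ, j)` with `σ ∈ F(M)`, `e, f` of the SAME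
colour `c ≠ j`, and `e, f` `(c,j)`-linked.  CLASSWISE KEMPE IDENTITY (`fiber_sum_pairVal`, from the pair lemma of the companion file):
`Σ_{σ ∈ F(M)} (2·[e,f same colour] − [different]) = L₌(M;e,f) − Λ(M;e,f)`.  Summing the pointwise normal form over all colourings
(`kempe_identity`):  `3·Q(G) = 6·|A*| + 3·Σ_{M a 2-matching}(L₌ − Λ)(M) + Σ_{M a 3-matching} Σ_{pairs p ⊆ M}(L₌ − Λ)(M;p)`, hence
`Q(G) ≥ 2|A*| − Λ(G)` (`six_card_Astar_le`): Lemma B for graph clutters FOLLOWS from the linked inequality `Λ ≤ 2|A*| + L₌` of the memo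
(census-clean for all 288 259 graphs on 4–9 vertices, min ratio 2.067 at `K₅`; the weight-one form `Λ ≤ p` has min ratio 31/30 at `K₅`).
-/

namespace Summit.CriticalPhenomena.PercolationContinuityZ3.Theorems.SunflowerPartition.Kempe

open Finset

open scoped Classical

variable {V : Type*} [Fintype V] (G : SimpleGraph V)

/-! ## Moving along Kempe chains -/

omit [Fintype V] in
/-- Kempe reachability is symmetric. [this work] -/
theorem KReach.symm' {σ : V → Fin 3} {a b : Fin 3} {u v : V} (h : KReach G σ a b u v) : KReach G σ a b v u := by
  unfold KReach at *
  induction h with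
  | refl => exact Relation.ReflTransGen.refl
  | tail _ hst ih => exact Relation.ReflTransGen.head ⟨hst.1.symm, hst.2.2, hst.2.1⟩ ih

omit [Fintype V] in
/-- The `(a,b)`-chains are the `(b,a)`-chains. [this work] -/
theorem KReach_swap (σ : V → Fin 3) (a b : Fin 3) (u v : V) : KReach G σ a b u v ↔ KReach G σ b a u v := by
  have h : KStep G σ a b = KStep G σ b a := by
    funext x y; simp only [KStep, eq_iff_iff]; tauto
  unfold KReach; rw [h]

omit [Fintype V] in
/-- The end of a chain may be moved along a monochromatic edge of colour `a` or `b`. [this work] -/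
theorem KReach_end_iff {σ : V → Fin 3} {a b : Fin 3} {q v v' : V} (hadj : G.Adj v v') (hc : σ v = σ v')
    (hv : σ v = a ∨ σ v = b) : KReach G σ a b q v ↔ KReach G σ a b q v' := by
  have hv' : σ v' = a ∨ σ v' = b := hc ▸ hv
  exact ⟨fun h => h.step G hadj hv hv', fun h => h.step G hadj.symm hv' hv⟩

omit [Fintype V] in
/-- The start of a chain may be moved along a monochromatic edge of colour `a` or `b`. [this work] -/
theorem KReach_start_iff {σ : V → Fin 3} {a b : Fin 3} {q q' v : V} (hadj : G.Adj q q') (hc : σ q = σ q')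
    (hq : σ q = a ∨ σ q = b) : KReach G σ a b q v ↔ KReach G σ a b q' v :=
  ⟨fun h => ((KReach_end_iff G hadj hc hq).1 h.symm').symm', fun h => ((KReach_end_iff G hadj hc hq).2 h.symm').symm'⟩

/-! ## Classes with a prescribed monochromatic set -/

/-- Two colourings with the same monochromatic relation on adjacent pairs have the same monochromatic set. [this work] -/
theorem monoSet_eq_of_mono_iff {σ τ : V → Fin 3} (h : ∀ u v, G.Adj u v → (σ u = σ v ↔ τ u = τ v)) :
    monoSet G σ = monoSet G τ := by
  ext e
  induction e using Sym2.ind with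
  | _ u v =>
    rw [mk_mem_monoSet_iff, mk_mem_monoSet_iff]
    constructor
    · rintro ⟨ha, hc⟩; exact ⟨ha, (h u v ha).1 hc⟩
    · rintro ⟨ha, hc⟩; exact ⟨ha, (h u v ha).2 hc⟩

/-- The class "the monochromatic set is exactly `M`" is mono-determined (so Kempe flips preserve it). [this work] -/
theorem monoDetermined_monoSet_eq (M : Finset (Sym2 V)) : MonoDetermined G (fun σ => monoSet G σ = M) := by
  intro σ τ h hσ
  rw [← monoSet_eq_of_mono_iff G h]; exact hσ

/-- An edge of `G` has two adjacent ends. [this work] -/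
theorem exists_ends_of_mem_edges {e : Sym2 V} (he : e ∈ edges G) : ∃ u v, G.Adj u v ∧ e = s(u, v) := by
  rw [mem_edges] at he
  induction e using Sym2.ind with
  | _ u v => exact ⟨u, v, (mk_mem_edgeSet_iff G u v).1 he, rfl⟩

/-! ## Linked pairs of edges and the classwise quantities `Λ`, `L₌` -/

omit [Fintype V] in
/-- `e, f` are Kempe-LINKED in `σ`: every end of `f` reaches every end of `e` inside the Kempe graph of their two colours
(for monochromatic `e, f` all these conditions are equivalent, `linked_iff_of_fiber`). [this work] -/
def Linked (σ : V → Fin 3) (e f : Sym2 V) : Prop := ∀ u ∈ e, ∀ v ∈ f, KReach G σ (σ u) (σ v) v u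

omit [Fintype V] in
/-- `e, f` are `(colour of e, j)`-linked and `j` is not the colour of `e`. [this work] -/
def LinkedIn (σ : V → Fin 3) (j : Fin 3) (e f : Sym2 V) : Prop := ∀ u ∈ e, ∀ v ∈ f, σ u ≠ j ∧ KReach G σ (σ u) j v u

/-- `Λ(M; p)`: colourings of the class `F(M)` in which the (two) edges of `p` carry different colours and are linked. [this work] -/
noncomputable def LK (M p : Finset (Sym2 V)) : ℕ :=
  ((fiber G M).filter fun σ => DiffOn σ p ∧ ∀ e ∈ p, ∀ f ∈ p, e ≠ f → Linked G σ e f).card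

/-- `L₌(M; p)`: pairs `(σ, j)` with `σ ∈ F(M)`, the edges of `p` of one colour `c ≠ j`, and linked in the `(c,j)`-Kempe graph. [this work] -/
noncomputable def LE (M p : Finset (Sym2 V)) : ℕ :=
  ((fiber G M).sigma fun σ => (univ : Finset (Fin 3)).filter fun j =>
    SameOn σ p ∧ ∀ e ∈ p, ∀ f ∈ p, e ≠ f → LinkedIn G σ j e f).card

/-! ## The classwise Kempe identity -/

/-- In a class containing the edge `s(x₁,x₂)` that edge is monochromatic. [this work] -/
theorem col_eq_of_fiber {M : Finset (Sym2 V)} {σ : V → Fin 3} (hσ : monoSet G σ = M) {x₁ x₂ : V}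
    (hx : s(x₁, x₂) ∈ M) : σ x₁ = σ x₂ := by
  rw [← hσ] at hx; exact ((mk_mem_monoSet_iff G σ x₁ x₂).1 hx).2

section Classwise

variable {M : Finset (Sym2 V)} {x₁ x₂ y₁ y₂ : V} (hx : G.Adj x₁ x₂) (hy : G.Adj y₁ y₂)
  (hxM : s(x₁, x₂) ∈ M) (hyM : s(y₁, y₂) ∈ M) (hef : s(x₁, x₂) ≠ s(y₁, y₂))

include hxM hyM in
/-- In the class, "same colour pattern" is `σ x₁ = σ y₁`. [this work] -/
theorem sameOn_iff_of_fiber {σ : V → Fin 3} (hσ : monoSet G σ = M) :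
    SameOn σ {s(x₁, x₂), s(y₁, y₂)} ↔ σ x₁ = σ y₁ := by
  rw [sameOn_pair, Sym2.map_mk, Sym2.map_mk, col_eq_of_fiber G hσ hxM, col_eq_of_fiber G hσ hyM, Sym2.eq_iff]
  tauto

include hxM hyM hef in
/-- In the class, "different colour patterns" is `σ x₁ ≠ σ y₁`. [this work] -/
theorem diffOn_iff_of_fiber {σ : V → Fin 3} (hσ : monoSet G σ = M) :
    DiffOn σ {s(x₁, x₂), s(y₁, y₂)} ↔ σ x₁ ≠ σ y₁ := by
  rw [diffOn_pair hef, Ne, Sym2.map_mk, Sym2.map_mk, col_eq_of_fiber G hσ hxM, col_eq_of_fiber G hσ hyM, Sym2.eq_iff]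
  tauto

include hx hy hxM hyM in
/-- In the class, `Linked` (either order) is reachability of `x₁` from `y₁` in the `(σ x₁, σ y₁)`-Kempe graph. [this work] -/
theorem linked_iff_of_fiber {σ : V → Fin 3} (hσ : monoSet G σ = M) :
    (Linked G σ s(x₁, x₂) s(y₁, y₂) ↔ KReach G σ (σ x₁) (σ y₁) y₁ x₁) ∧
    (Linked G σ s(y₁, y₂) s(x₁, x₂) ↔ KReach G σ (σ x₁) (σ y₁) y₁ x₁) := by
  have hcx := col_eq_of_fiber G hσ hxM
  have hcy := col_eq_of_fiber G hσ hyM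
  have ex : ∀ q : V, KReach G σ (σ x₁) (σ y₁) q x₂ ↔ KReach G σ (σ x₁) (σ y₁) q x₁ := fun q =>
    (KReach_end_iff G hx hcx (Or.inl rfl)).symm
  have ey : ∀ v : V, KReach G σ (σ x₁) (σ y₁) y₂ v ↔ KReach G σ (σ x₁) (σ y₁) y₁ v := fun v =>
    (KReach_start_iff G hy hcy (Or.inr rfl)).symm
  have all : KReach G σ (σ x₁) (σ y₁) y₁ x₁ → ∀ u ∈ s(x₁, x₂), ∀ v ∈ s(y₁, y₂),
      σ u = σ x₁ ∧ σ v = σ y₁ ∧ KReach G σ (σ x₁) (σ y₁) v u := by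
    intro h u hu v hv
    have hv' : σ v = σ y₁ ∧ KReach G σ (σ x₁) (σ y₁) v x₁ := by
      rcases Sym2.mem_iff.1 hv with rfl | rfl
      · exact ⟨rfl, h⟩
      · exact ⟨hcy.symm, (ey _).2 h⟩
    rcases Sym2.mem_iff.1 hu with rfl | rfl
    · exact ⟨rfl, hv'.1, hv'.2⟩
    · exact ⟨hcx.symm, hv'.1, (ex _).2 hv'.2⟩
  refine ⟨⟨fun h => h x₁ (Sym2.mem_mk_left _ _) y₁ (Sym2.mem_mk_left _ _), fun h u hu v hv => ?_⟩,
    ⟨fun h => ?_, fun h v hv u hu => ?_⟩⟩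
  · obtain ⟨hcu, hcv, h1⟩ := all h u hu v hv
    rw [hcu, hcv]; exact h1
  · have h1 := h y₁ (Sym2.mem_mk_left _ _) x₁ (Sym2.mem_mk_left _ _)
    exact ((KReach_swap G σ _ _ _ _).1 h1).symm'
  · obtain ⟨hcu, hcv, h1⟩ := all h u hu v hv
    rw [hcu, hcv, KReach_swap]; exact h1.symm'

include hx hy hxM hyM in
/-- In the class, with the two edges of the same colour `c = σ x₁`, `LinkedIn j` (either order) is `c ≠ j` together with
`(c,j)`-reachability of `x₁` from `y₁`. [this work] -/
theorem linkedIn_iff_of_fiber {σ : V → Fin 3} (hσ : monoSet G σ = M) (hs : σ x₁ = σ y₁) (j : Fin 3) :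
    (LinkedIn G σ j s(x₁, x₂) s(y₁, y₂) ↔ σ x₁ ≠ j ∧ KReach G σ (σ x₁) j y₁ x₁) ∧
    (LinkedIn G σ j s(y₁, y₂) s(x₁, x₂) ↔ σ x₁ ≠ j ∧ KReach G σ (σ x₁) j y₁ x₁) := by
  have hcx := col_eq_of_fiber G hσ hxM
  have hcy := col_eq_of_fiber G hσ hyM
  have ex : ∀ q : V, KReach G σ (σ x₁) j q x₂ ↔ KReach G σ (σ x₁) j q x₁ := fun q =>
    (KReach_end_iff G hx hcx (Or.inl rfl)).symm
  have ey : ∀ v : V, KReach G σ (σ x₁) j y₂ v ↔ KReach G σ (σ x₁) j y₁ v := fun v =>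
    (KReach_start_iff G hy hcy (Or.inl hs.symm)).symm
  have all : KReach G σ (σ x₁) j y₁ x₁ → ∀ u ∈ s(x₁, x₂), ∀ v ∈ s(y₁, y₂),
      σ u = σ x₁ ∧ σ v = σ x₁ ∧ KReach G σ (σ x₁) j v u ∧ KReach G σ (σ x₁) j u v := by
    intro h u hu v hv
    have hv' : σ v = σ x₁ ∧ KReach G σ (σ x₁) j v x₁ := by
      rcases Sym2.mem_iff.1 hv with rfl | rfl
      · exact ⟨hs.symm, h⟩
      · exact ⟨hcy.symm.trans hs.symm, (ey _).2 h⟩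
    rcases Sym2.mem_iff.1 hu with rfl | rfl
    · exact ⟨rfl, hv'.1, hv'.2, hv'.2.symm'⟩
    · exact ⟨hcx.symm, hv'.1, (ex _).2 hv'.2, ((ex _).2 hv'.2).symm'⟩
  refine ⟨⟨fun h => h x₁ (Sym2.mem_mk_left _ _) y₁ (Sym2.mem_mk_left _ _), fun ⟨hj, h⟩ u hu v hv => ?_⟩,
    ⟨fun h => ?_, fun ⟨hj, h⟩ v hv u hu => ?_⟩⟩
  · obtain ⟨hcu, -, h1, -⟩ := all h u hu v hv
    rw [hcu]; exact ⟨hj, h1⟩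
  · obtain ⟨hj, h1⟩ := h y₁ (Sym2.mem_mk_left _ _) x₁ (Sym2.mem_mk_left _ _)
    rw [← hs] at hj h1
    exact ⟨hj, h1.symm'⟩
  · obtain ⟨-, hcv, -, h2⟩ := all h u hu v hv
    rw [hcv]; exact ⟨hj, h2⟩

include hx hy hxM hyM hef in
/-- **CLASSWISE KEMPE IDENTITY** (memo §2–§3): over the class `F(M)`, `Σ (2·[x, y same colour] − [different colours]) = L₌(M; x,y) − Λ(M; x,y)`
— the Kempe pair lemma `kempe_pair_card_eq` plus the bookkeeping `#sepTarget + #(linked same-colour directions) = 2·#eqSet`. [this work] -/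
theorem fiber_sum_pairVal_ends :
    ∑ σ ∈ fiber G M, pairVal σ {s(x₁, x₂), s(y₁, y₂)} =
      (LE G M {s(x₁, x₂), s(y₁, y₂)} : ℤ) - LK G M {s(x₁, x₂), s(y₁, y₂)} := by
  set P : (V → Fin 3) → Prop := fun σ => monoSet G σ = M with hP
  have hPmd : MonoDetermined G P := monoDetermined_monoSet_eq G M
  -- the sets of this file are the sets of the companion file
  have eSame : ((fiber G M).filter fun σ => SameOn σ {s(x₁, x₂), s(y₁, y₂)}) = eqSet P x₁ x₂ y₁ y₂ := by
    ext σ; simp only [fiber, eqSet, mem_filter, mem_univ, true_and]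
    constructor
    · rintro ⟨hσ, h⟩
      exact ⟨hσ, col_eq_of_fiber G hσ hxM, col_eq_of_fiber G hσ hyM, (sameOn_iff_of_fiber G hxM hyM hσ).1 h⟩
    · rintro ⟨hσ, -, -, h⟩; exact ⟨hσ, (sameOn_iff_of_fiber G hxM hyM hσ).2 h⟩
  have eDiff : ((fiber G M).filter fun σ => DiffOn σ {s(x₁, x₂), s(y₁, y₂)}) = neSet P x₁ x₂ y₁ y₂ := by
    ext σ; simp only [fiber, neSet, mem_filter, mem_univ, true_and]
    constructor
    · rintro ⟨hσ, h⟩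
      exact ⟨hσ, col_eq_of_fiber G hσ hxM, col_eq_of_fiber G hσ hyM, (diffOn_iff_of_fiber G hxM hyM hef hσ).1 h⟩
    · rintro ⟨hσ, -, -, h⟩; exact ⟨hσ, (diffOn_iff_of_fiber G hxM hyM hef hσ).2 h⟩
  have eLink : ((fiber G M).filter fun σ => DiffOn σ {s(x₁, x₂), s(y₁, y₂)} ∧
      ∀ e ∈ ({s(x₁, x₂), s(y₁, y₂)} : Finset (Sym2 V)), ∀ f ∈ ({s(x₁, x₂), s(y₁, y₂)} : Finset (Sym2 V)), e ≠ f →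
        Linked G σ e f) = linkSet G P x₁ x₂ y₁ y₂ := by
    ext σ; simp only [fiber, linkSet, mem_filter, mem_univ, true_and]
    constructor
    · rintro ⟨hσ, hd, hl⟩
      refine ⟨hσ, col_eq_of_fiber G hσ hxM, col_eq_of_fiber G hσ hyM, (diffOn_iff_of_fiber G hxM hyM hef hσ).1 hd, ?_⟩
      exact (linked_iff_of_fiber G hx hy hxM hyM hσ).1.1
        (hl _ (mem_insert_self _ _) _ (mem_insert_of_mem (mem_singleton_self _)) hef)
    · rintro ⟨hσ, -, -, hd, hk⟩
      refine ⟨hσ, (diffOn_iff_of_fiber G hxM hyM hef hσ).2 hd, fun e he f hf hne => ?_⟩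
      simp only [mem_insert, mem_singleton] at he hf
      rcases he with rfl | rfl <;> rcases hf with rfl | rfl
      · exact absurd rfl hne
      · exact (linked_iff_of_fiber G hx hy hxM hyM hσ).1.2 hk
      · exact (linked_iff_of_fiber G hx hy hxM hyM hσ).2.2 hk
      · exact absurd rfl hne
  have eLE : ((fiber G M).sigma fun σ => (univ : Finset (Fin 3)).filter fun j => SameOn σ {s(x₁, x₂), s(y₁, y₂)} ∧
      ∀ e ∈ ({s(x₁, x₂), s(y₁, y₂)} : Finset (Sym2 V)), ∀ f ∈ ({s(x₁, x₂), s(y₁, y₂)} : Finset (Sym2 V)), e ≠ f →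
        LinkedIn G σ j e f) =
      (eqSet P x₁ x₂ y₁ y₂).sigma fun ρ => (univ : Finset (Fin 3)).filter fun j => j ≠ ρ x₁ ∧ KReach G ρ (ρ x₁) j y₁ x₁ := by
    ext ⟨σ, j⟩
    simp only [mem_sigma, mem_filter, mem_univ, true_and, fiber, eqSet]
    constructor
    · rintro ⟨hσ, hs, hl⟩
      have hs' := (sameOn_iff_of_fiber G hxM hyM hσ).1 hs
      obtain ⟨hj, hk⟩ := (linkedIn_iff_of_fiber G hx hy hxM hyM hσ hs' j).1.1
        (hl _ (mem_insert_self _ _) _ (mem_insert_of_mem (mem_singleton_self _)) hef)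
      exact ⟨⟨hσ, col_eq_of_fiber G hσ hxM, col_eq_of_fiber G hσ hyM, hs'⟩, fun h => hj h.symm, hk⟩
    · rintro ⟨⟨hσ, -, -, hs'⟩, hj, hk⟩
      refine ⟨hσ, (sameOn_iff_of_fiber G hxM hyM hσ).2 hs', fun e he f hf hne => ?_⟩
      simp only [mem_insert, mem_singleton] at he hf
      rcases he with rfl | rfl <;> rcases hf with rfl | rfl
      · exact absurd rfl hne
      · exact (linkedIn_iff_of_fiber G hx hy hxM hyM hσ hs' j).1.2 ⟨fun h => hj h.symm, hk⟩
      · exact (linkedIn_iff_of_fiber G hx hy hxM hyM hσ hs' j).2.2 ⟨fun h => hj h.symm, hk⟩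
      · exact absurd rfl hne
  -- the two complementary direction sets fill `eqSet × {j ≠ c}`
  have csum : (sepTarget G P x₁ x₂ y₁ y₂).card + ((eqSet P x₁ x₂ y₁ y₂).sigma fun ρ =>
      (univ : Finset (Fin 3)).filter fun j => j ≠ ρ x₁ ∧ KReach G ρ (ρ x₁) j y₁ x₁).card = 2 * (eqSet P x₁ x₂ y₁ y₂).card := by
    unfold sepTarget
    rw [card_sigma, card_sigma, ← sum_add_distrib]
    have h2 : ∀ ρ ∈ eqSet P x₁ x₂ y₁ y₂,
        ((univ : Finset (Fin 3)).filter fun j => j ≠ ρ x₁ ∧ ¬KReach G ρ (ρ x₁) j y₁ x₁).card +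
        ((univ : Finset (Fin 3)).filter fun j => j ≠ ρ x₁ ∧ KReach G ρ (ρ x₁) j y₁ x₁).card = 2 := by
      intro ρ _
      rw [← filter_filter, ← filter_filter, add_comm,
        card_filter_add_card_filter_not (fun j => KReach G ρ (ρ x₁) j y₁ x₁), card_ne_colour]
    rw [sum_congr rfl h2, sum_const, smul_eq_mul, mul_comm]
  -- the pair lemma and the separable/linked dichotomy
  have hpair := kempe_pair_card_eq G hPmd hx hy
  have hdich := card_sepSet_add_card_linkSet G P x₁ x₂ y₁ y₂
  -- the class sum of the pair weights
  have hsum : ∑ σ ∈ fiber G M, pairVal σ {s(x₁, x₂), s(y₁, y₂)} =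
      2 * (((fiber G M).filter fun σ => SameOn σ {s(x₁, x₂), s(y₁, y₂)}).card : ℤ) -
        (((fiber G M).filter fun σ => DiffOn σ {s(x₁, x₂), s(y₁, y₂)}).card : ℤ) := by
    unfold pairVal
    rw [sum_sub_distrib, sum_ite, sum_ite, sum_const_zero, sum_const_zero, add_zero, add_zero, sum_const, sum_const,
      nsmul_eq_mul, nsmul_eq_mul, mul_one, mul_comm]
  rw [hsum, eSame, eDiff, LE, LK, eLink, eLE]
  omega

end Classwise

/-! ## Summation over the classes -/

/-- Re-indexing a sum over colourings by their monochromatic set. [this work] -/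
theorem sum_fiber (S : Finset (Finset (Sym2 V))) (h : Finset (Sym2 V) → (V → Fin 3) → ℤ) :
    ∑ M ∈ S, ∑ σ ∈ fiber G M, h M σ = ∑ σ : V → Fin 3, if monoSet G σ ∈ S then h (monoSet G σ) σ else 0 := by
  unfold fiber
  simp_rw [sum_filter]
  rw [sum_comm]
  refine sum_congr rfl fun σ _ => ?_
  rw [sum_ite_eq]

/-- The members of `match2` are pairs of edges. [this work] -/
theorem mem_match2 {M : Finset (Sym2 V)} (hM : M ∈ match2 G) : M ⊆ edges G ∧ M.card = 2 := by
  unfold match2 at hM; rw [mem_filter, mem_powerset] at hM; exact ⟨hM.1, hM.2.1⟩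

/-- The members of `match3` are triples of edges. [this work] -/
theorem mem_match3 {M : Finset (Sym2 V)} (hM : M ∈ match3 G) : M ⊆ edges G ∧ M.card = 3 := by
  unfold match3 at hM; rw [mem_filter, mem_powerset] at hM; exact ⟨hM.1, hM.2.1⟩

/-- The classwise identity for a pair `p ⊆ M ⊆ E(G)` of edges. [this work] -/
theorem fiber_sum_pairVal {M p : Finset (Sym2 V)} (hM : M ⊆ edges G) (hp : p ⊆ M) (hcard : p.card = 2) :
    ∑ σ ∈ fiber G M, pairVal σ p = (LE G M p : ℤ) - LK G M p := by
  obtain ⟨e, f, hef, rfl⟩ := card_eq_two.1 hcard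
  have he : e ∈ M := hp (mem_insert_self _ _)
  have hf : f ∈ M := hp (mem_insert_of_mem (mem_singleton_self _))
  obtain ⟨x₁, x₂, hx, rfl⟩ := exists_ends_of_mem_edges G (hM he)
  obtain ⟨y₁, y₂, hy, rfl⟩ := exists_ends_of_mem_edges G (hM hf)
  exact fiber_sum_pairVal_ends G hx hy he hf hef

/-! ## The Kempe identity and its first consequence -/

/-- **THE KEMPE IDENTITY** (memo §3): `3·Q(G) = 6·|A*| + 3·Σ_{2-matchings M} (L₌ − Λ)(M) + Σ_{3-matchings M} Σ_{pairs p ⊆ M} (L₌ − Λ)(M; p)`.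
Everything Kempe-separable has cancelled exactly (this is where `sK₂`, `s ≤ 3`, is tight); what is left of Lemma B is a statement
about pairs of monochromatic edges joined by a two-coloured path. [this work] -/
theorem kempe_identity :
    3 * Qcol G = 6 * ((Astar G).card : ℤ) + 3 * ∑ M ∈ match2 G, ((LE G M M : ℤ) - LK G M M)
      + ∑ M ∈ match3 G, ∑ p ∈ M.powersetCard 2, ((LE G M p : ℤ) - LK G M p) := by
  have h1 : ∑ σ : V → Fin 3, (6 : ℤ) * (if σ ∈ Astar G then 1 else 0) = 6 * ((Astar G).card : ℤ) := by
    have hA : ((univ : Finset (V → Fin 3)).filter fun σ => σ ∈ Astar G) = Astar G := by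
      rw [filter_mem_eq_inter, univ_inter]
    rw [← mul_sum, sum_boole, hA]
  have h2 : ∑ σ : V → Fin 3, (if monoSet G σ ∈ match2 G then 3 * pairVal σ (monoSet G σ) else 0) =
      3 * ∑ M ∈ match2 G, ((LE G M M : ℤ) - LK G M M) := by
    rw [← sum_fiber G (match2 G) (fun M σ => 3 * pairVal σ M), mul_sum]
    refine sum_congr rfl fun M hM => ?_
    obtain ⟨hsub, hcard⟩ := mem_match2 G hM
    rw [← mul_sum, fiber_sum_pairVal G hsub subset_rfl hcard]
  have h3 : ∑ σ : V → Fin 3, (if monoSet G σ ∈ match3 G then ∑ p ∈ (monoSet G σ).powersetCard 2, pairVal σ p else 0) =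
      ∑ M ∈ match3 G, ∑ p ∈ M.powersetCard 2, ((LE G M p : ℤ) - LK G M p) := by
    rw [← sum_fiber G (match3 G) (fun M σ => ∑ p ∈ M.powersetCard 2, pairVal σ p)]
    refine sum_congr rfl fun M hM => ?_
    obtain ⟨hsub, -⟩ := mem_match3 G hM
    rw [sum_comm]
    refine sum_congr rfl fun p hp => ?_
    obtain ⟨hpM, hpc⟩ := mem_powersetCard.1 hp
    exact fiber_sum_pairVal G hsub hpM hpc
  calc 3 * Qcol G = ∑ σ : V → Fin 3, 3 * qcol G σ := by unfold Qcol; rw [mul_sum]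
    _ = ∑ σ : V → Fin 3, ((6 : ℤ) * (if σ ∈ Astar G then 1 else 0)
          + (if monoSet G σ ∈ match2 G then 3 * pairVal σ (monoSet G σ) else 0)
          + (if monoSet G σ ∈ match3 G then ∑ p ∈ (monoSet G σ).powersetCard 2, pairVal σ p else 0)) :=
        sum_congr rfl fun σ _ => three_qcol_eq G σ
    _ = _ := by rw [sum_add_distrib, sum_add_distrib, h1, h2, h3]

/-- **`Q(G) ≥ 2|A*| − Λ(G)`** (memo §4): dropping the same-colour credits `L₌ ≥ 0`,
`6·|A*| ≤ 3·Q(G) + 3·Σ_{2-matchings} Λ + Σ_{3-matchings} Σ_pairs Λ`.  Hence Lemma B for the graph (`0 ≤ Q(G)`) follows from the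
LINKED INEQUALITY `3·Σ₂Λ + Σ₃Σ_pairs Λ ≤ 6·|A*|` (a fortiori from `Λ ≤ 2|A*| + L₌`). [this work] -/
theorem six_card_Astar_le :
    6 * ((Astar G).card : ℤ) ≤ 3 * Qcol G + 3 * ∑ M ∈ match2 G, (LK G M M : ℤ)
      + ∑ M ∈ match3 G, ∑ p ∈ M.powersetCard 2, (LK G M p : ℤ) := by
  rw [kempe_identity]
  have h2 : 0 ≤ ∑ M ∈ match2 G, (LE G M M : ℤ) := sum_nonneg fun _ _ => Nat.cast_nonneg _
  have h3 : 0 ≤ ∑ M ∈ match3 G, ∑ p ∈ M.powersetCard 2, (LE G M p : ℤ) :=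
    sum_nonneg fun _ _ => sum_nonneg fun _ _ => Nat.cast_nonneg _
  simp only [sum_sub_distrib]
  linarith

/-- **Lemma B from the linked inequality**: if the linked differently-coloured pairs are paid by `A*` twice and the linked
same-colour directions, `3·Σ₂Λ + Σ₃ΣΛ ≤ 6|A*| + 3·Σ₂L₌ + Σ₃ΣL₌`, then `0 ≤ Q(G)`. [this work] -/
theorem Qcol_nonneg_of_linked
    (h : 3 * ∑ M ∈ match2 G, (LK G M M : ℤ) + ∑ M ∈ match3 G, ∑ p ∈ M.powersetCard 2, (LK G M p : ℤ) ≤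
      6 * ((Astar G).card : ℤ) + 3 * ∑ M ∈ match2 G, (LE G M M : ℤ) + ∑ M ∈ match3 G, ∑ p ∈ M.powersetCard 2, (LE G M p : ℤ)) :
    0 ≤ Qcol G := by
  have := kempe_identity G
  simp only [sum_sub_distrib] at this
  linarith

end Summit.CriticalPhenomena.PercolationContinuityZ3.Theorems.SunflowerPartition.Kempe
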